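import Summits.Ventures.PercRepro.RankDistBookRank

/-!
# PercRepro — THE TIGHT LAYER OF THE BOOK `B_k`: ground set, rank, bottom sets and up-set (p9, gen 23)

`B_k = book f hf` (`RankDistBook`, `RankDistBookRank`) has `2k + 1` elements and rank `k + 1` (`card_gr_book`,
`eRank_book`): its tight layer is `(p, q) = (k + 1, k)`. From the rank formula `rk_book` and the pattern of a
complement (`bookSp_compl`, `bookFull_compl`, `bookMiss_compl`):
* `mem_Uq_book` — **the bottom sets** are the subsets with no full pair and `#miss = [e₀ ∈ B]`: the `2^k`
  transversals of the pairs, and `e₀` plus a transversal of `k − 1` pairs (`k · 2^{k−1}` sets);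
* `exists_mem_Uq_subset_iff_book` — **the up-set**: `A ⊆ E` contains a bottom set iff `#miss(A) ≤ [e₀ ∈ A]`
  (a transversal of the hit pairs, `bookTrans`, with `e₀` added when one pair is missed).
`RankDistBookPattern` counts subsets of `E` by their pattern `(ε, g) : Bool × (Fin k → Finset Bool)`, and
`RankDistBookLevels` derives the two shadow levels `s_q = 2^k + k · 3^{k−1}`, `s_p = 2 · 3^k − 2^k` and the failure
of TOP for `k ≥ 6`. Nothing here moves any window of the crux.
-/

namespace PercRepro.RankDist

open Set Finset _root_.Matroid PercRepro.ThmH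

variable {α : Type} [DecidableEq α] {k : ℕ} (f : Option (Fin k × Bool) → α)

/-! ## The ground set and the rank of the book -/

omit [DecidableEq α] in
/-- The book has `2k + 1` elements. -/
lemma card_gr_book (hf : Function.Injective f) : (gr (book f hf)).card = (k + 1) + k := by
  rw [card_gr, book_ground, Set.ncard_range_of_injective hf, Nat.card_eq_fintype_card, Fintype.card_option,
    Fintype.card_prod, Fintype.card_fin, Fintype.card_bool]
  ring

omit [DecidableEq α] in
/-- The pattern of the ground set: `e₀` is there and every pair is full. -/
lemma bookSp_range : bookSp f (Set.range f) = 1 := (bookSp_eq_one_iff f _).2 (Set.mem_range_self _)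

omit [DecidableEq α] in
/-- Every pair is hit by the ground set. -/
lemma bookHit_range : bookHit f (Set.range f) = Finset.univ := by
  ext i; simp [mem_bookHit]

omit [DecidableEq α] in
/-- The book has rank `k + 1`. -/
lemma eRank_book (hf : Function.Injective f) : (book f hf).eRank = ((k + 1 : ℕ) : ℕ∞) := by
  rw [eRank_def, book_ground, eRk_eq_coe_rk (book f hf) (by rw [book_ground]), rk_book f hf (subset_refl _),
    bookSp_range, bookHit_range, Finset.card_univ, Fintype.card_fin]
  have : min 1 (1 + (bookFull f (Set.range f)).card) = 1 := by omega
  rw [this]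

omit [DecidableEq α] in
/-- A subset of the ground finset is a subset of `range f`. -/
lemma coe_subset_range_of_subset_gr (hf : Function.Injective f) {B : Finset α} (hB : B ⊆ gr (book f hf)) : (B : Set α) ⊆ Set.range f := by
  rw [← book_ground f hf, ← coe_gr]; exact Finset.coe_subset.2 hB

/-! ## The pattern of a complement -/

omit [DecidableEq α] in
/-- `e₀` lies in `E ∖ B` iff it does not lie in `B`. -/
lemma bookSp_compl {B : Set α} : bookSp f (Set.range f \ B) + bookSp f B = 1 := by
  unfold bookSp
  by_cases h : f none ∈ B
  · rw [if_pos h, if_neg (fun h' => h'.2 h)]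
  · rw [if_neg h, if_pos ⟨Set.mem_range_self _, h⟩]

omit [DecidableEq α] in
/-- The pairs full in `E ∖ B` are the pairs missed by `B`. -/
lemma bookFull_compl (B : Set α) : bookFull f (Set.range f \ B) = bookMiss f B := by
  ext i
  simp only [mem_bookFull, mem_bookMiss, Set.mem_sdiff, Set.mem_range_self, true_and]

omit [DecidableEq α] in
/-- The pairs missed by `E ∖ B` are the pairs full in `B`. -/
lemma bookMiss_compl (B : Set α) : bookMiss f (Set.range f \ B) = bookFull f B := by
  ext i
  simp only [mem_bookMiss, mem_bookFull, Set.mem_sdiff, Set.mem_range_self, true_and, not_not]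

/-! ## The bottom sets -/

/-- **The bottom sets of the book**: `B` is a bottom set of the tight layer `(k + 1, k)` iff `B ⊆ E`, no pair is
full in `B`, and `B` misses exactly `[e₀ ∈ B]` pairs. -/
theorem mem_Uq_book (hf : Function.Injective f) {B : Finset α} :
    B ∈ PerFlat.Uq (book f hf) (k + 1) k ↔
      B ⊆ gr (book f hf) ∧ bookFull f (B : Set α) = ∅ ∧ (bookMiss f (B : Set α)).card = bookSp f (B : Set α) := by
  rw [mem_Uq_tight (book f hf) (card_gr_book f hf) (eRank_book f hf)]
  constructor
  · rintro ⟨hBE, hind, hcard, hbase⟩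
    have hBr : (B : Set α) ⊆ Set.range f := coe_subset_range_of_subset_gr f hf hBE
    have hcompl : ((gr (book f hf) \ B : Finset α) : Set α) = Set.range f \ (B : Set α) := by
      rw [Finset.coe_sdiff, coe_gr, book_ground]
    -- the complement is independent of rank `k + 1`
    have hDind : BookIndep f (Set.range f \ (B : Set α)) := by
      rw [← hcompl]; exact hbase.indep
    have hDsub : Set.range f \ (B : Set α) ⊆ (book f hf).E := Set.sdiff_subset
    have hDrk : rk (book f hf) (Set.range f \ (B : Set α)) = k + 1 := by
      rw [rk_eq_iff (book f hf) hDsub, ← hcompl, hbase.eRk_eq_eRank, eRank_book]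
    rw [rk_book f hf Set.sdiff_subset] at hDrk
    have hfullD := bookFull_compl f (B : Set α)
    have hmissD := bookMiss_compl f (B : Set α)
    have hspD := bookSp_compl f (B := (B : Set α))
    have hhm := card_bookHit_add_card_bookMiss f (Set.range f \ (B : Set α))
    have hspB := bookSp_le_one f (B : Set α)
    have hcnt := hDind.2
    rw [hfullD] at hDrk hcnt
    rw [hmissD] at hhm
    refine ⟨hBE, ?_, ?_⟩
    · rw [← Finset.card_eq_zero]; omega
    · omega
  · rintro ⟨hBE, hfull, hmiss⟩
    have hBr : (B : Set α) ⊆ Set.range f := coe_subset_range_of_subset_gr f hf hBE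
    have hsize := ncard_eq_pattern f hf hBr
    have hhm := card_bookHit_add_card_bookMiss f (B : Set α)
    have hspB := bookSp_le_one f (B : Set α)
    rw [hfull, Finset.card_empty] at hsize
    have hcompl : ((gr (book f hf) \ B : Finset α) : Set α) = Set.range f \ (B : Set α) := by
      rw [Finset.coe_sdiff, coe_gr, book_ground]
    refine ⟨hBE, ⟨hBr, by rw [hfull, Finset.card_empty]; omega⟩, ?_, ?_⟩
    · rw [← Set.ncard_coe_finset]; omega
    · -- the complement is independent and spanning
      have hDind : (book f hf).Indep (Set.range f \ (B : Set α)) := by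
        rw [book_indep_iff]
        refine ⟨Set.sdiff_subset, ?_⟩
        have := bookSp_compl f (B := (B : Set α))
        rw [bookFull_compl]; omega
      have hDrk : rk (book f hf) (Set.range f \ (B : Set α)) = k + 1 := by
        rw [rk_book f hf Set.sdiff_subset, bookFull_compl]
        have hhmD := card_bookHit_add_card_bookMiss f (Set.range f \ (B : Set α))
        rw [bookMiss_compl, hfull, Finset.card_empty] at hhmD
        have := bookSp_compl f (B := (B : Set α))
        omega
      rw [hcompl]
      have hDsub : Set.range f \ (B : Set α) ⊆ (book f hf).E := Set.sdiff_subset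
      refine hDind.isBase_of_eRk_ge ((Set.finite_range f).subset Set.sdiff_subset) ?_
      rw [eRank_book, eRk_eq_coe_rk (book f hf) hDsub, hDrk]

/-! ## The up-set -/

/-- A choice of one element of `A` in each pair hit by `A`. -/
noncomputable def bookPick (A : Set α) (i : Fin k) : Bool :=
  @ite _ (f (some (i, false)) ∈ A) (Classical.propDecidable _) false true

omit [DecidableEq α] in
/-- The chosen element lies in `A` when the pair is hit. -/
lemma pick_mem {A : Set α} {i : Fin k} (hi : i ∈ bookHit f A) : f (some (i, bookPick f A i)) ∈ A := by
  unfold bookPick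
  split_ifs with h
  · exact h
  · exact ((mem_bookHit f).1 hi).resolve_left h

/-- The transversal of the pairs hit by `A`. -/
noncomputable def bookTrans (A : Set α) : Finset α := (bookHit f A).image (fun i => f (some (i, bookPick f A i)))

/-- Membership in the transversal. -/
lemma mem_bookTrans {A : Set α} {x : α} :
    x ∈ bookTrans f A ↔ ∃ i ∈ bookHit f A, f (some (i, bookPick f A i)) = x := by
  unfold bookTrans; simp

/-- The transversal lies in `A`. -/
lemma coe_bookTrans_subset (A : Set α) : (bookTrans f A : Set α) ⊆ A := by
  intro x hx
  rw [Finset.mem_coe, mem_bookTrans] at hx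
  obtain ⟨i, hi, rfl⟩ := hx
  exact pick_mem f hi

/-- `e₀` is not in the transversal. -/
lemma none_notMem_bookTrans (hf : Function.Injective f) (A : Set α) : f none ∉ (bookTrans f A : Set α) := by
  intro hx
  rw [Finset.mem_coe, mem_bookTrans] at hx
  obtain ⟨i, -, h⟩ := hx
  have := hf h
  simp at this

/-- The pattern of the transversal: the pair `i` contains exactly the chosen element. -/
lemma mem_bookTrans_iff (hf : Function.Injective f) (A : Set α) (i : Fin k) (b : Bool) :
    f (some (i, b)) ∈ (bookTrans f A : Set α) ↔ i ∈ bookHit f A ∧ b = bookPick f A i := by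
  rw [Finset.mem_coe, mem_bookTrans]
  constructor
  · rintro ⟨j, hj, h⟩
    have := hf h
    simp only [Option.some.injEq, Prod.mk.injEq] at this
    obtain ⟨rfl, rfl⟩ := this
    exact ⟨hj, rfl⟩
  · rintro ⟨hi, rfl⟩
    exact ⟨i, hi, rfl⟩

/-- The transversal has no full pair. -/
lemma bookFull_bookTrans (hf : Function.Injective f) (A : Set α) : bookFull f (bookTrans f A : Set α) = ∅ := by
  ext i
  simp only [Finset.notMem_empty, iff_false]
  rw [mem_bookFull, mem_bookTrans_iff f hf, mem_bookTrans_iff f hf]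
  rintro ⟨⟨-, h1⟩, ⟨-, h2⟩⟩
  rw [← h2] at h1
  exact Bool.false_ne_true h1

/-- The transversal misses exactly the pairs missed by `A`. -/
lemma bookMiss_bookTrans (hf : Function.Injective f) (A : Set α) :
    bookMiss f (bookTrans f A : Set α) = bookMiss f A := by
  ext i
  rw [mem_bookMiss, mem_bookMiss, mem_bookTrans_iff f hf, mem_bookTrans_iff f hf]
  constructor
  · rintro ⟨h1, h2⟩
    by_contra h
    have hi : i ∈ bookHit f A := by
      rw [mem_bookHit]
      by_contra h'
      exact h ⟨fun h0 => h' (Or.inl h0), fun h0 => h' (Or.inr h0)⟩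
    cases hb : bookPick f A i
    · exact h1 ⟨hi, hb.symm⟩
    · exact h2 ⟨hi, hb.symm⟩
  · intro h
    have hi : i ∉ bookHit f A := by
      rw [mem_bookHit]
      rintro (h0 | h0)
      · exact h.1 h0
      · exact h.2 h0
    exact ⟨fun h' => hi h'.1, fun h' => hi h'.1⟩

/-- **The up-set of the bottom sets**: `A ⊆ E` contains a bottom set iff `#miss(A) ≤ [e₀ ∈ A]`. -/
theorem exists_mem_Uq_subset_iff_book (hf : Function.Injective f) {A : Set α} (hA : A ⊆ Set.range f) :
    (∃ B ∈ PerFlat.Uq (book f hf) (k + 1) k, (B : Set α) ⊆ A) ↔ (bookMiss f A).card ≤ bookSp f A := by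
  constructor
  · rintro ⟨B, hB, hBA⟩
    obtain ⟨-, -, hmiss⟩ := (mem_Uq_book f hf).1 hB
    have h1 : bookMiss f A ⊆ bookMiss f (B : Set α) := by
      intro i hi
      rw [mem_bookMiss] at hi ⊢
      exact ⟨fun h => hi.1 (hBA h), fun h => hi.2 (hBA h)⟩
    have := Finset.card_le_card h1
    have := bookSp_mono f hBA
    omega
  · intro h
    have hT : (bookTrans f A : Set α) ⊆ Set.range f := (coe_bookTrans_subset f A).trans hA
    have hTgr : bookTrans f A ⊆ gr (book f hf) := by
      rw [← Finset.coe_subset, coe_gr, book_ground]; exact hT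
    rcases Nat.eq_zero_or_pos (bookMiss f A).card with h0 | hpos
    · -- the transversal itself
      refine ⟨bookTrans f A, ?_, coe_bookTrans_subset f A⟩
      rw [mem_Uq_book]
      refine ⟨hTgr, bookFull_bookTrans f hf A, ?_⟩
      rw [bookMiss_bookTrans f hf, h0, (bookSp_eq_zero_iff f _).2 (none_notMem_bookTrans f hf A)]
    · -- `e₀` plus the transversal
      have hsp : bookSp f A = 1 := by have := bookSp_le_one f A; omega
      have hnone : f none ∈ A := (bookSp_eq_one_iff f A).1 hsp
      refine ⟨insert (f none) (bookTrans f A), ?_, ?_⟩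
      · rw [mem_Uq_book, Finset.coe_insert]
        refine ⟨Finset.insert_subset (by rw [← Finset.mem_coe, coe_gr, book_ground]; exact Set.mem_range_self _) hTgr,
          ?_, ?_⟩
        · rw [bookFull_insert_none f hf, bookFull_bookTrans f hf]
        · have hmi : bookMiss f (insert (f none) (bookTrans f A : Set α)) = bookMiss f A := by
            ext i
            simp only [mem_bookMiss, Set.mem_insert_iff]
            have h1 : f (some (i, false)) ≠ f none := fun h => by simpa using hf h
            have h2 : f (some (i, true)) ≠ f none := fun h => by simpa using hf h
            simp only [h1, h2, false_or]
            rw [← mem_bookMiss, ← mem_bookMiss, bookMiss_bookTrans f hf]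
          rw [hmi, bookSp_insert_none]
          omega
      · rw [Finset.coe_insert]
        exact Set.insert_subset hnone (coe_bookTrans_subset f A)

end PercRepro.RankDist
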